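import Mathlib
import Literature.AlgebraicGeometry.Resolution.PolygonChartTransportIndexed
import HarnessLib

/-!
# The polygon under a point blow-up, origin of the `u₁`-chart, ARBITRARY embedding dimension:
# `α′ = δ − 1`, `β′ = γ⁻ ≤ β`, `ε′ = ε`, `ζ′ ≤ ζ + ε − 1`

Topic: `Literature/AlgebraicGeometry/Resolution`. Dimension-general form of `PointBlowupPolygonLaws.lean` (`c : Fin 3 → R`): seventh brick of the
generalisation `Fin 3 → Fin (r+2)` of the tree's expansion-free rendering of Hironaka's characteristic polyhedra (memo
`run/shared/lean/pub/res-hironaka/L/res-L1-w42-stub-3/KEYCLAIM-PORT-PLAN.md` §4–§5). Cossart–Jannsen–Saito, LNM 2270, **Lemma 12.1 (3)**: at the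
origin `x′` of the `u₁`-chart of the blowing up of the closed point, for the weak transform `J′ = (J R′ : u₁^μ)` of an idealistic exponent
`(J, μ)` with `δ(J) > 1`, `α(J′) = δ(J) − 1`, `β(J′) = γ⁻(J) ≤ β(J)`; and the behaviour of the lowest vertex used in the proof of CJS
Thm. 13.7: `ε′ = ε`, `ζ′ ≤ ζ + ε − 1`. All for the SCALED integer invariants of `PolygonInvariantsIndexed` (`c : Fin (r + 2) → R` with a
block of `r` y-variables), in the pivot-general chart setting of `PolygonChartTransportIndexed` with pivot `u1 r`. Statements and proofs are
those of the `Fin 3` file verbatim.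

* `levelWeight_eq_pullbackWeightAt_u1`, `forall_pts_colon_of_forall_pts` (transport of half-planes), `lowerBound_pts_colon`,
  `deltaS_le_spt₁_colon_add`, `gammaMinusS_le_spt₂_colon`, `exists_pts_colon_wMinus` (realisation of `w⁻`), `pts_colon_nonempty`;
* **laws** `alphaS_colon_add` (`αs′ + L = δs`), `betaS_colon_eq` (`βs′ = γ⁻s`), `betaS_colon_le` (`βs′ ≤ βs`), `exists_pts_colon_zeta`,
  `epsS_le_spt₂_colon`, `epsS_colon_eq` (`εs′ = εs`), `zetaS_colon_add_le` (`ζs′ + L ≤ ζs + εs`).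

Sources: V. Cossart, U. Jannsen, S. Saito, LNM **2270** (2020), Lemma 12.1 (3), proof of Thm. 13.7 (p. 172) [`CossartJannsenSaito2020`];
V. Cossart, O. Piltant, J. Algebra 320 (2008), proof of Lemma 4.5, p. 12, (21) [`CossartPiltant2008`]. No named facts; no instance,
notation or attribute.
-/

noncomputable section

open IsLocalRing MvPolynomial

namespace Literature.AlgebraicGeometry.Resolution

namespace WeightedOrder

universe u

section Chart

variable {R R' : Type u} [CommRing R] [CommRing R'] (φ : R →+* R') {r : ℕ} {c : Fin (r + 2) → R}
  {c' : Fin (r + 2) → R'} (hpiv : c' (u1 r) = φ (c (u1 r))) (hoth : ∀ i, i ≠ u1 r → φ (c i) = φ (c (u1 r)) * c' i)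
  [IsRegularLocalRing R] [IsRegularLocalRing R']
  (hgen : Ideal.span (Set.range c) = maximalIdeal R) (hdim : ringKrullDim R = r + 2)
  (hgen' : Ideal.span (Set.range c') = maximalIdeal R') (hdim' : ringKrullDim R' = r + 2)
  {J : Ideal R} {μ : ℕ}

/-- The level weight `(w₀′ + L p₁′, L p₁′, L (p₁′ + p₂′))` is the pull-back of the level weight
`(w₀′, L p₁′, L p₂′)` of the chart. [cite: CossartJannsenSaito2020, Lemma 12.1 (3)] -/
theorem levelWeight_eq_pullbackWeightAt_u1 (μ w₀' p₁' p₂' : ℕ) :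
    levelWeight (r := r) μ (w₀' + μ.factorial * p₁') p₁' (p₁' + p₂') =
      pullbackWeightAt (u1 r) (levelWeight μ w₀' p₁' p₂') := by
  funext i
  by_cases hi : i = u1 r
  · subst hi; rw [pullbackWeightAt_self, levelWeight_u1, levelWeight_u1]
  · rw [pullbackWeightAt_of_ne _ hi, levelWeight_u1]
    revert hi
    refine Fin.addCases (fun k hk => ?_) (fun k hk => ?_) i
    · rw [levelWeight_y, levelWeight_y]
    · fin_cases k
      · exact absurd rfl hk
      · change levelWeight μ _ p₁' (p₁' + p₂') (u2 r) = levelWeight μ w₀' p₁' p₂' (u2 r) + _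
        rw [levelWeight_u2, levelWeight_u2]; ring

include hpiv hoth hgen hdim hgen' hdim' in
/-- **Transport of half-planes** (CJS Lemma 12.1 (3), "`Δ′ ⊆` minimal `F`-subset containing
`Ψ(Δ)`"): if every point of `pts c J μ` satisfies `p₁′ x₁ + (p₁′ + p₂′) x₂ ≥ w₀′ + L p₁′`
(i.e. `p₁′ (x₁ + x₂ − L) + p₂′ x₂ ≥ w₀′`), then every point of `pts c′ J′ μ` satisfies
`p₁′ x₁ + p₂′ x₂ ≥ w₀′` (`w₀′, p₁′, p₂′ > 0`). [cite: CossartJannsenSaito2020, Lemma 12.1 (3)] -/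
theorem forall_pts_colon_of_forall_pts {w₀' p₁' p₂' : ℕ} (hw₀' : 0 < w₀') (hp₁' : 0 < p₁')
    (hp₂' : 0 < p₂')
    (hS : ∀ e ∈ pts c J μ, w₀' + μ.factorial * p₁' ≤ p₁' * spt₁ μ e + (p₁' + p₂') * spt₂ μ e) :
    ∀ e' ∈ pts c' ((J.map φ).colon {φ (c (u1 r)) ^ μ}) μ, w₀' ≤ p₁' * spt₁ μ e' + p₂' * spt₂ μ e' := by
  have hJ : J ≤ weightedOrderIdeal c (levelWeight μ (w₀' + μ.factorial * p₁') p₁' (p₁' + p₂'))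
      ((w₀' + μ.factorial * p₁') * μ) :=
    (le_weightedOrderIdeal_levelWeight_iff c hgen hdim J (by omega) hp₁' (by omega)).mpr hS
  rw [levelWeight_eq_pullbackWeightAt_u1] at hJ
  have hlev : (w₀' + μ.factorial * p₁') * μ = w₀' * μ + μ * (levelWeight μ w₀' p₁' p₂' (u1 r)) := by
    rw [levelWeight_u1]; ring
  rw [hlev] at hJ
  have hW' := levelWeight_pos (r := r) (μ := μ) hw₀' hp₁' hp₂'
  have hJ' := colon_le_weightedOrderIdeal_of_le_chartAt φ (u1 r) hpiv hoth _ hgen' hdim' hW' hJ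
  exact (le_weightedOrderIdeal_levelWeight_iff c' hgen' hdim' _ hw₀' hp₁' hp₂').mp hJ'

include hpiv hoth hgen hdim hgen' hdim' in
/-- **Lower bound for the new abscissae**: if `δ(J) > 1` (scaled: `L < δs`) then every point of
the weak transform satisfies `N x₁′ + x₂′ ≥ N (δs − L) + γ⁻s` for all `N ≥ γ⁻s + 1` — the
half-planes through `Ψ(w⁻) = (δ − 1, γ⁻)` steeper than the image of the `δ`-face.
[cite: CossartJannsenSaito2020, Lemma 12.1 (3)] -/
theorem lowerBound_pts_colon (hδ : μ.factorial < deltaS c J μ) {N : ℕ}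
    (hN : gammaMinusS c J μ + 1 ≤ N) :
    ∀ e' ∈ pts c' ((J.map φ).colon {φ (c (u1 r)) ^ μ}) μ, N * (deltaS c J μ - μ.factorial) + gammaMinusS c J μ ≤
      N * spt₁ μ e' + 1 * spt₂ μ e' := by
  refine forall_pts_colon_of_forall_pts φ hpiv hoth hgen hdim hgen' hdim' ?_ (by omega)
    Nat.one_pos fun e he => ?_
  · have : 1 ≤ deltaS c J μ - μ.factorial := by omega
    calc 0 < N * 1 := by omega
      _ ≤ N * (deltaS c J μ - μ.factorial) := Nat.mul_le_mul_left _ this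
      _ ≤ _ := Nat.le_add_right _ _
  · have hkey : N * (deltaS c J μ - μ.factorial) + μ.factorial * N = N * deltaS c J μ := by
      rw [Nat.mul_sub, mul_comm (μ.factorial) N]
      exact Nat.sub_add_cancel (Nat.mul_le_mul_left _ hδ.le)
    have hsplit : N * spt₁ μ e + (N + 1) * spt₂ μ e = N * (spt₁ μ e + spt₂ μ e) + spt₂ μ e := by
      ring
    rw [hsplit]
    have hδe := deltaS_le he
    rcases hδe.eq_or_lt with heq | hlt
    · have hγ := gammaMinusS_le he heq.symm
      rw [← heq]; omega
    · have h1 : deltaS c J μ + 1 ≤ spt₁ μ e + spt₂ μ e := hlt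
      have h2 := Nat.mul_le_mul_left N h1
      rw [Nat.mul_add, mul_one] at h2
      omega

include hpiv hoth hgen hdim hgen' hdim' in
/-- Every point of the weak transform has abscissa `≥ δ − 1` (scaled: `spt₁′ + L ≥ δs`).
[cite: CossartJannsenSaito2020, Lemma 12.1 (3)] [cite: CossartPiltant2008, (21)] -/
theorem deltaS_le_spt₁_colon_add (hδ : μ.factorial < deltaS c J μ) {e' : Fin (r + 2) →₀ ℕ}
    (he' : e' ∈ pts c' ((J.map φ).colon {φ (c (u1 r)) ^ μ}) μ) : deltaS c J μ ≤ spt₁ μ e' + μ.factorial := by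
  by_contra hlt
  push Not at hlt
  set N := gammaMinusS c J μ + spt₂ μ e' + 1 with hN
  have h := lowerBound_pts_colon φ hpiv hoth hgen hdim hgen' hdim' hδ (N := N) (by omega) e' he'
  have h1 : spt₁ μ e' + 1 ≤ deltaS c J μ - μ.factorial := by omega
  have h2 : N * (spt₁ μ e' + 1) ≤ N * (deltaS c J μ - μ.factorial) := Nat.mul_le_mul_left _ h1
  rw [Nat.mul_add, mul_one] at h2
  omega

include hpiv hoth hgen hdim hgen' hdim' in
/-- On the line `x₁′ = δ − 1` the new ordinates are `≥ γ⁻`. [cite: CossartJannsenSaito2020, Lemma 12.1 (3)] -/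
theorem gammaMinusS_le_spt₂_colon (hδ : μ.factorial < deltaS c J μ) {e' : Fin (r + 2) →₀ ℕ}
    (he' : e' ∈ pts c' ((J.map φ).colon {φ (c (u1 r)) ^ μ}) μ) (h1 : spt₁ μ e' + μ.factorial = deltaS c J μ) :
    gammaMinusS c J μ ≤ spt₂ μ e' := by
  have h := lowerBound_pts_colon φ hpiv hoth hgen hdim hgen' hdim' hδ le_rfl e' he'
  have : spt₁ μ e' = deltaS c J μ - μ.factorial := by omega
  rw [this] at h
  omega

include hpiv hoth hgen hdim hgen' hdim' in
/-- **Realisation of `w⁻`**: the vertex `w⁻ = (δ − γ⁻, γ⁻)` of `Δ(J)` goes up to the point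
`Ψ(w⁻) = (δ − 1, γ⁻)` of the weak transform (`δ > 1`, `J ⊆ 𝔪^μ`).
[cite: CossartJannsenSaito2020, Lemma 12.1 (3)] -/
theorem exists_pts_colon_wMinus (hJμ : J ≤ maximalIdeal R ^ μ) (hne : (pts c J μ).Nonempty)
    (hδ : μ.factorial < deltaS c J μ) :
    ∃ e' ∈ pts c' ((J.map φ).colon {φ (c (u1 r)) ^ μ}) μ, spt₁ μ e' + μ.factorial = deltaS c J μ ∧ spt₂ μ e' = gammaMinusS c J μ := by
  obtain ⟨e, he, hsum, h2⟩ := exists_pts_wMinus hne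
  -- `e` minimises `ℓ = N spt₁ + (N+1) spt₂`, `N = γ⁻ + 1`
  set N := gammaMinusS c J μ + 1 with hN
  have hmin : ∀ x ∈ pts c J μ, N * spt₁ μ e + (N + 1) * spt₂ μ e ≤
      N * spt₁ μ x + (N + 1) * spt₂ μ x := by
    have key := isMinOn_lex (S := pts c J μ) (ℓ₁ := fun x => spt₁ μ x + spt₂ μ x) (ℓ₂ := spt₂ μ)
      (e := e) (fun x hx => by rw [hsum]; exact deltaS_le hx)
      (fun x hx hx1 => by rw [h2]; exact gammaMinusS_le hx (by rw [hx1, hsum]))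
    intro x hx
    have := key x hx
    have hx1 : N * spt₁ μ e + (N + 1) * spt₂ μ e = N * (spt₁ μ e + spt₂ μ e) + spt₂ μ e := by ring
    have hx2 : N * spt₁ μ x + (N + 1) * spt₂ μ x = N * (spt₁ μ x + spt₂ μ x) + spt₂ μ x := by ring
    rw [hx1, hx2]
    simpa [hN, h2] using this
  have hℓ : N * spt₁ μ e + (N + 1) * spt₂ μ e = N * deltaS c J μ + gammaMinusS c J μ := by
    rw [← hsum, ← h2]; ring
  have hNδ : N * μ.factorial + N ≤ N * deltaS c J μ := by
    have := Nat.mul_le_mul_left N (show μ.factorial + 1 ≤ deltaS c J μ from hδ)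
    rwa [Nat.mul_add, mul_one] at this
  have hpos : 0 < N * spt₁ μ e + (N + 1) * spt₂ μ e := by rw [hℓ]; omega
  obtain ⟨f, hf, hinit⟩ := exists_isInitialTerm_levelWeight_of_isMinOn c hgen hdim (by omega)
    (by omega) he hmin hpos
  -- the weight is the pull-back of `(N δs + γ⁻s − L N, L N, L)`
  have hsub : μ.factorial * N ≤ N * spt₁ μ e + (N + 1) * spt₂ μ e := by
    rw [hℓ, mul_comm]; omega
  set w₀' := N * spt₁ μ e + (N + 1) * spt₂ μ e - μ.factorial * N with hw₀'
  have hwt : levelWeight μ (N * spt₁ μ e + (N + 1) * spt₂ μ e) N (N + 1) =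
      pullbackWeightAt (u1 r) (levelWeight μ w₀' N 1) := by
    rw [← levelWeight_eq_pullbackWeightAt_u1, Nat.sub_add_cancel hsub]
  rw [hwt] at hinit
  have hW' : ∀ i : Fin (r + 2), 0 < levelWeight μ w₀' N 1 i := by
    refine levelWeight_pos ?_ (by omega) Nat.one_pos
    rw [hw₀', hℓ, mul_comm (μ.factorial) N]
    omega
  refine ⟨chartPtAt (u1 r) μ e, chartPtAt_mem_pts_u1 φ _ hgen hdim hgen' hdim' hW' hpiv hoth hJμ hf he.2 hinit, ?_, ?_⟩
  · have := spt₁_chartPtAt_u1_add he.2 (le_degree_of_mem_occ c hgen hdim hJμ he.1)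
    omega
  · rw [spt₂_chartPtAt_u1, h2]

include hpiv hoth hgen hdim hgen' hdim' in
/-- The weak transform has Newton points of `y`-degree `< μ`. [cite: CossartJannsenSaito2020, Lemma 12.1 (3)] -/
theorem pts_colon_nonempty (hJμ : J ≤ maximalIdeal R ^ μ) (hne : (pts c J μ).Nonempty)
    (hδ : μ.factorial < deltaS c J μ) : (pts c' ((J.map φ).colon {φ (c (u1 r)) ^ μ}) μ).Nonempty := by
  obtain ⟨e', he', -⟩ := exists_pts_colon_wMinus φ hpiv hoth hgen hdim hgen' hdim' hJμ hne hδ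
  exact ⟨e', he'⟩

include hpiv hoth hgen hdim hgen' hdim' in
/-- **CJS Lemma 12.1 (3), first law**: `α(J′) = δ(J) − 1` (scaled: `αs′ + L = δs`).
[cite: CossartJannsenSaito2020, Lemma 12.1 (3)] [cite: CossartPiltant2008, (21)] -/
theorem alphaS_colon_add (hJμ : J ≤ maximalIdeal R ^ μ) (hne : (pts c J μ).Nonempty)
    (hδ : μ.factorial < deltaS c J μ) : alphaS c' ((J.map φ).colon {φ (c (u1 r)) ^ μ}) μ + μ.factorial = deltaS c J μ := by
  have hne' := pts_colon_nonempty φ hpiv hoth hgen hdim hgen' hdim' hJμ hne hδ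
  obtain ⟨e', he', h1, -⟩ := exists_pts_colon_wMinus φ hpiv hoth hgen hdim hgen' hdim' hJμ hne hδ
  refine le_antisymm ?_ ?_
  · have := alphaS_le he'; omega
  · obtain ⟨a, ha, ha1⟩ := exists_pts_alphaS hne'
    have := deltaS_le_spt₁_colon_add φ hpiv hoth hgen hdim hgen' hdim' hδ ha
    omega

include hpiv hoth hgen hdim hgen' hdim' in
/-- **CJS Lemma 12.1 (3), second law**: `β(J′) = γ⁻(J)`. [cite: CossartJannsenSaito2020, Lemma 12.1 (3)] -/
theorem betaS_colon_eq (hJμ : J ≤ maximalIdeal R ^ μ) (hne : (pts c J μ).Nonempty)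
    (hδ : μ.factorial < deltaS c J μ) : betaS c' ((J.map φ).colon {φ (c (u1 r)) ^ μ}) μ = gammaMinusS c J μ := by
  have hα := alphaS_colon_add φ hpiv hoth hgen hdim hgen' hdim' hJμ hne hδ
  obtain ⟨e', he', h1, h2⟩ := exists_pts_colon_wMinus φ hpiv hoth hgen hdim hgen' hdim' hJμ hne hδ
  have hne' : (pts c' ((J.map φ).colon {φ (c (u1 r)) ^ μ}) μ).Nonempty := ⟨e', he'⟩
  refine le_antisymm ?_ ?_
  · rw [← h2]; exact betaS_le he' (by omega)
  · obtain ⟨b, hb, hb1, hb2⟩ := exists_pts_v hne'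
    rw [← hb2]
    exact gammaMinusS_le_spt₂_colon φ hpiv hoth hgen hdim hgen' hdim' hδ hb (by omega)

include hpiv hoth hgen hdim hgen' hdim' in
/-- **`β` does not increase at the origin of the `u₁`-chart**: `β(J′) ≤ β(J)`
(CJS Lemma 12.1 (3): `β′ = γ⁻ ≤ β`; Cossart–Piltant Lemma 4.5 (2) at `x′₀`).
[cite: CossartJannsenSaito2020, Lemma 12.1 (3)] [cite: CossartPiltant2008, Lemma 4.5 (2)] -/
theorem betaS_colon_le (hJμ : J ≤ maximalIdeal R ^ μ) (hne : (pts c J μ).Nonempty)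
    (hδ : μ.factorial < deltaS c J μ) : betaS c' ((J.map φ).colon {φ (c (u1 r)) ^ μ}) μ ≤ betaS c J μ := by
  rw [betaS_colon_eq φ hpiv hoth hgen hdim hgen' hdim' hJμ hne hδ]
  exact (gammaMinusS_le_gammaPlusS hne).trans (gammaPlusS_le_betaS hne)

/-! ### The lowest vertex: `ε′ = ε`, `ζ′ ≤ ζ + ε − 1` -/

include hpiv hoth hgen hdim hgen' hdim' in
/-- **Realisation of `(ζ, ε)`**: the lowest vertex goes up to `(ζ + ε − 1, ε)` (`δ > 1`,
`J ⊆ 𝔪^μ`). [cite: CossartJannsenSaito2020, proof of Thm. 13.7, p. 172] -/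
theorem exists_pts_colon_zeta (hJμ : J ≤ maximalIdeal R ^ μ) (hne : (pts c J μ).Nonempty)
    (hδ : μ.factorial < deltaS c J μ) :
    ∃ e' ∈ pts c' ((J.map φ).colon {φ (c (u1 r)) ^ μ}) μ, spt₂ μ e' = epsS c J μ ∧
      spt₁ μ e' + μ.factorial = zetaS c J μ + epsS c J μ := by
  obtain ⟨e, he, h2, h1⟩ := exists_pts_zeta hne
  set N := zetaS c J μ + 2 with hN
  -- `e` minimises `ℓ = spt₁ + N spt₂`
  have hmin : ∀ x ∈ pts c J μ, 1 * spt₁ μ e + N * spt₂ μ e ≤ 1 * spt₁ μ x + N * spt₂ μ x := by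
    have key := isMinOn_lex (S := pts c J μ) (ℓ₁ := spt₂ μ) (ℓ₂ := spt₁ μ) (e := e)
      (fun x hx => by rw [h2]; exact epsS_le hx)
      (fun x hx hx2 => by rw [h1]; exact zetaS_le hx (by rw [hx2, h2]))
    -- `e` is the lex minimiser of `(spt₂, spt₁)`; translate `key` (form `(ζs+1) spt₂ + spt₁`)
    intro x hx
    have hkx := key x hx
    rw [h1] at hkx ⊢
    have hex : epsS c J μ ≤ spt₂ μ x := epsS_le hx
    rw [← h2] at hex
    -- `N = (ζs + 1) + 1`: add `spt₂ e ≤ spt₂ x` to `key`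
    have hsplit : ∀ t : ℕ, N * t = (zetaS c J μ + 1) * t + t := by intro t; rw [hN]; ring
    rw [hsplit, hsplit]
    omega
  have hℓ : 1 * spt₁ μ e + N * spt₂ μ e = zetaS c J μ + N * epsS c J μ := by rw [← h1, ← h2]; ring
  have hδζ := deltaS_le_zetaS_add_epsS hne
  have hNε : epsS c J μ ≤ N * epsS c J μ := Nat.le_mul_of_pos_left _ (by omega)
  have hpos : 0 < 1 * spt₁ μ e + N * spt₂ μ e := by rw [hℓ]; omega
  obtain ⟨f, hf, hinit⟩ := exists_isInitialTerm_levelWeight_of_isMinOn c hgen hdim Nat.one_pos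
    (by omega) he hmin hpos
  have hsub : μ.factorial * 1 ≤ 1 * spt₁ μ e + N * spt₂ μ e := by rw [hℓ]; omega
  set w₀' := 1 * spt₁ μ e + N * spt₂ μ e - μ.factorial * 1 with hw₀'
  have hwt : levelWeight μ (1 * spt₁ μ e + N * spt₂ μ e) 1 N =
      pullbackWeightAt (u1 r) (levelWeight μ w₀' 1 (N - 1)) := by
    have hN1 : 1 + (N - 1) = N := by omega
    have := levelWeight_eq_pullbackWeightAt_u1 (r := r) μ w₀' 1 (N - 1)
    rw [hN1, hw₀', Nat.sub_add_cancel hsub] at this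
    exact this
  rw [hwt] at hinit
  have hW' : ∀ i : Fin (r + 2), 0 < levelWeight μ w₀' 1 (N - 1) i := by
    refine levelWeight_pos ?_ Nat.one_pos (by omega)
    rw [hw₀', hℓ]
    omega
  refine ⟨chartPtAt (u1 r) μ e, chartPtAt_mem_pts_u1 φ _ hgen hdim hgen' hdim' hW' hpiv hoth hJμ hf he.2 hinit, ?_, ?_⟩
  · rw [spt₂_chartPtAt_u1, h2]
  · have := spt₁_chartPtAt_u1_add he.2 (le_degree_of_mem_occ c hgen hdim hJμ he.1)
    omega

include hpiv hoth hgen hdim hgen' hdim' in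
/-- Lower bound for the new ordinates: `ε(J′) ≥ ε(J)`. [cite: CossartJannsenSaito2020, proof of Thm. 13.7] -/
theorem epsS_le_spt₂_colon (hδ : μ.factorial < deltaS c J μ)
    {e' : Fin (r + 2) →₀ ℕ} (he' : e' ∈ pts c' ((J.map φ).colon {φ (c (u1 r)) ^ μ}) μ) : epsS c J μ ≤ spt₂ μ e' := by
  by_contra hlt
  push Not at hlt
  -- transport the half-planes `x₁ + N x₂ ≥ N εs + δs − L`
  set N := spt₁ μ e' + 1 with hN
  have h := forall_pts_colon_of_forall_pts φ hpiv hoth hgen hdim hgen' hdim'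
    (w₀' := N * epsS c J μ + (deltaS c J μ - μ.factorial)) (p₁' := 1) (p₂' := N)
    (by omega) Nat.one_pos (by omega) (fun e he => by
      have h1 := deltaS_le he
      have h2 := epsS_le he
      have h3 : N * epsS c J μ ≤ N * spt₂ μ e := Nat.mul_le_mul_left _ h2
      have h4 : (1 + N) * spt₂ μ e = spt₂ μ e + N * spt₂ μ e := by ring
      rw [h4]
      omega) e' he'
  have h3 : N * (spt₂ μ e' + 1) ≤ N * epsS c J μ := Nat.mul_le_mul_left _ hlt
  rw [Nat.mul_add, mul_one] at h3
  omega

include hpiv hoth hgen hdim hgen' hdim' in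
/-- **`ε` is unchanged**: `ε(J′) = ε(J)`. [cite: CossartJannsenSaito2020, proof of Thm. 13.7, p. 172] -/
theorem epsS_colon_eq (hJμ : J ≤ maximalIdeal R ^ μ) (hne : (pts c J μ).Nonempty)
    (hδ : μ.factorial < deltaS c J μ) : epsS c' ((J.map φ).colon {φ (c (u1 r)) ^ μ}) μ = epsS c J μ := by
  obtain ⟨e', he', h2, -⟩ := exists_pts_colon_zeta φ hpiv hoth hgen hdim hgen' hdim' hJμ hne hδ
  have hne' : (pts c' ((J.map φ).colon {φ (c (u1 r)) ^ μ}) μ).Nonempty := ⟨e', he'⟩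
  refine le_antisymm ?_ ?_
  · rw [← h2]; exact epsS_le he'
  · obtain ⟨b, hb, hb2⟩ := exists_pts_epsS hne'
    rw [← hb2]
    exact epsS_le_spt₂_colon φ hpiv hoth hgen hdim hgen' hdim' hδ hb

include hpiv hoth hgen hdim hgen' hdim' in
/-- **The lowest vertex moves left by `1 − ε`**: `ζ(J′) + L ≤ ζ(J) + ε(J)`, i.e.
`ζ′ ≤ ζ + ε − 1 < ζ` when `ε < 1` (CJS, proof of Theorem 13.7: "`ζ^O(f^{(q)}) = ζ^O(f^{(q−1)}) +
ε^O − m_{q−1} < ζ^O(f^{(q−1)})`"). [cite: CossartJannsenSaito2020, proof of Thm. 13.7, p. 172] -/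
theorem zetaS_colon_add_le (hJμ : J ≤ maximalIdeal R ^ μ) (hne : (pts c J μ).Nonempty)
    (hδ : μ.factorial < deltaS c J μ) :
    zetaS c' ((J.map φ).colon {φ (c (u1 r)) ^ μ}) μ + μ.factorial ≤ zetaS c J μ + epsS c J μ := by
  obtain ⟨e', he', h2, h1⟩ := exists_pts_colon_zeta φ hpiv hoth hgen hdim hgen' hdim' hJμ hne hδ
  have hε := epsS_colon_eq φ hpiv hoth hgen hdim hgen' hdim' hJμ hne hδ
  have := zetaS_le he' (by rw [h2, hε])
  omega

end Chart

end WeightedOrder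

end Literature.AlgebraicGeometry.Resolution

end
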